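import Mathlib
import Literature.NumberTheory.Transcendental.KZLogCalculusProofs
import Literature.NumberTheory.Transcendental.SemialgebraicMapsProofs

/-!
# `TateLifting` (stmt-KontsevichZagierPeriods-9129), line `Sketch` — the area of a band between two
# semialgebraic graphs is one Newton–Leibniz move away from its base representation

In the genus-zero sector of the line, AREAS of plane regions bounded by conic arcs enter as integral
representations `[B, 1]` over a BAND `B = {(x, y) | x ∈ τ, α x ≤ y ≤ β x} ⊆ ℝⁿ⁺¹` (base coordinates
`Fin.init z`, fibre coordinate `z (Fin.last n)` — exactly the band format of Kontsevich–Zagier's rule (3),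
`KZ.newtonLeibnizRel`). This file proves `tateLifting_bandArea`: ONE Newton–Leibniz move with the
primitive `F z := z (Fin.last n)` (so `∂F/∂y = 1 =` the integrand and `F (x, β x) − F (x, α x) = β x − α x`)
turns `[B, 1]` into the honest base representation `r' = [τ, β − α]`, i.e.
`[B, 1] − [τ, β − α] ∈ KZ.relations`.

The only non-formal point is the HONESTY of `r'`: the integrand `β − α ≥ 0` must be absolutely integrable
on `τ`. This is read off the finite area of the band: `∫⁻_τ (β − α) = vol B < ∞`, by Tonelli along the
last coordinate (`ℝⁿ⁺¹ ≃ ℝ × ℝⁿ` through the volume-preserving `MeasurableEquiv.piFinSuccAbove`, whose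
inverse is `(t, x) ↦ Fin.snoc x t`, and `MeasureTheory.Measure.prod_apply_symm`), the fibre of `B` over
`x ∈ τ` being the interval `[α x, β x]` of length `β x − α x`.

References: M. Kontsevich, D. Zagier, *Periods* (2001), §1.2 rule (3) ("Newton–Leibniz").
-/

noncomputable section

open MeasureTheory Set
open Literature.NumberTheory.Transcendental
open Literature.ModelTheory.ExponentialFields (IsSemialgebraic)

namespace Summit.KontsevichZagierPeriods.InverseLandau

namespace BandArea

variable {n : ℕ}

/-- **Tonelli along the last coordinate.** The volume of a measurable `A ⊆ ℝⁿ⁺¹` is the lower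
integral over the base `ℝⁿ` of the lengths of its vertical fibres `{t | Fin.snoc x t ∈ A}`
(transport along the volume-preserving `MeasurableEquiv.piFinSuccAbove _ (Fin.last n)` and
`MeasureTheory.Measure.prod_apply_symm`). [folklore] -/
theorem volume_eq_lintegral_fibre {A : Set (Fin (n + 1) → ℝ)} (hA : MeasurableSet A) :
    volume A = ∫⁻ x : Fin n → ℝ, volume {t : ℝ | (Fin.snoc x t : Fin (n + 1) → ℝ) ∈ A} := by
  set e : (Fin (n + 1) → ℝ) ≃ᵐ ℝ × (Fin n → ℝ) :=
    MeasurableEquiv.piFinSuccAbove (fun _ => ℝ) (Fin.last n) with he_def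
  have he : MeasurePreserving e volume (volume.prod volume) :=
    volume_preserving_piFinSuccAbove (fun _ => ℝ) (Fin.last n)
  have hsymm : ∀ p : ℝ × (Fin n → ℝ), e.symm p = Fin.snoc p.2 p.1 := fun p => by
    rw [he_def, MeasurableEquiv.piFinSuccAbove_symm_apply, Fin.insertNthEquiv_last]
    rfl
  have h1 := he.symm.measure_preimage (μa := volume.prod volume) (s := A) hA.nullMeasurableSet
  rw [← h1, Measure.prod_apply_symm (e.symm.measurable hA)]
  refine lintegral_congr fun x => ?_
  congr 1
  ext t
  simp only [mem_preimage, hsymm, mem_setOf_eq]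

/-- **The area of a band is the integral of its width.** For a measurable band
`B = {z | init z ∈ τ ∧ α (init z) ≤ z last ≤ β (init z)}` over a measurable base `τ`,
`∫⁻_τ (β − α) = vol B` (Tonelli along the last coordinate; the fibre over `x ∈ τ` is `[α x, β x]`).
[folklore] -/
theorem lintegral_width_eq_volume {τ : Set (Fin n → ℝ)} (hτm : MeasurableSet τ)
    {α β : (Fin n → ℝ) → ℝ} {B : Set (Fin (n + 1) → ℝ)} (hBm : MeasurableSet B)
    (hB : B = {z | (Fin.init z : Fin n → ℝ) ∈ τ ∧ α (Fin.init z) ≤ z (Fin.last n) ∧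
      z (Fin.last n) ≤ β (Fin.init z)}) :
    ∫⁻ x in τ, ENNReal.ofReal (β x - α x) = volume B := by
  have hmem : ∀ (x : Fin n → ℝ) (t : ℝ),
      (Fin.snoc x t : Fin (n + 1) → ℝ) ∈ B ↔ x ∈ τ ∧ t ∈ Icc (α x) (β x) := by
    intro x t
    rw [hB]
    simp only [mem_setOf_eq, Fin.init_snoc, Fin.snoc_last, mem_Icc]
  rw [volume_eq_lintegral_fibre hBm, ← lintegral_indicator hτm]
  refine lintegral_congr fun x => ?_
  by_cases hx : x ∈ τ
  · rw [indicator_of_mem hx]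
    have hfib : {t : ℝ | (Fin.snoc x t : Fin (n + 1) → ℝ) ∈ B} = Icc (α x) (β x) := by
      ext t
      simp only [mem_setOf_eq, hmem, hx, true_and]
    rw [hfib, Real.volume_Icc]
  · rw [indicator_of_notMem hx]
    have hfib : {t : ℝ | (Fin.snoc x t : Fin (n + 1) → ℝ) ∈ B} = ∅ := by
      ext t
      simp only [mem_setOf_eq, hmem, hx, false_and, mem_empty_iff_false]
    rw [hfib, measure_empty]

/-- A representation whose integrand is `1` on its domain has a domain of finite volume. [folklore] -/
theorem volume_lt_top_of_eqOn_one (r : KZ.IntegralRep (n + 1))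
    (h1 : EqOn r.integrand (fun _ => 1) r.domain) : volume r.domain < ⊤ := by
  have hint : IntegrableOn (fun _ => (1 : ℝ)) r.domain :=
    r.integrableOn.congr_fun h1 (KZ.IntegralRep.measurableSet_domain_holds r)
  have h2 := hint.2
  unfold HasFiniteIntegral at h2
  rwa [lintegral_const, Measure.restrict_apply_univ, enorm_one, one_mul] at h2

end BandArea

/-- **Area of a band between two semialgebraic graphs, by one Newton–Leibniz move.** Let `τ ⊆ ℝⁿ` be
`ℚ`-semialgebraic, `α ≤ β` two `ℚ`-semialgebraic functions on `τ`, and `r = [B, f]` an integral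
representation of dimension `n + 1` whose domain is the band
`B = {z | init z ∈ τ ∧ α (init z) ≤ z last ≤ β (init z)}` and whose integrand is `1` on `B`. Then the base
representation `r' = [τ, β − α]` EXISTS as an honest integral representation (its integrand is absolutely
integrable because `∫_τ (β − α) = vol B < ∞`, Tonelli) and `[B, f] − [τ, β − α] ∈ KZ.relations`: one
Newton–Leibniz move along the last coordinate with primitive `F z = z last`, for which `∂F/∂t = 1 = f`
on the open fibres and `F (x, β x) − F (x, α x) = β x − α x`.
[cite: KontsevichZagier2001, §1.2 rule (3)] -/
theorem tateLifting_bandArea :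
    ∀ (n : ℕ) (r : KZ.IntegralRep (n + 1)) (τ : Set (Fin n → ℝ)) (α β : (Fin n → ℝ) → ℝ),
      IsSemialgebraic ℚ τ → IsSemialgebraicFunOn ℚ τ α → IsSemialgebraicFunOn ℚ τ β →
      (∀ x ∈ τ, α x ≤ β x) →
      r.domain = {z | (Fin.init z : Fin n → ℝ) ∈ τ ∧ α (Fin.init z) ≤ z (Fin.last n) ∧
        z (Fin.last n) ≤ β (Fin.init z)} →
      Set.EqOn r.integrand (fun _ => 1) r.domain →
      ∃ r' : KZ.IntegralRep n, r'.domain = τ ∧ (r'.integrand = fun x => β x - α x) ∧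
        KZ.of r - KZ.of r' ∈ KZ.relations := by
  intro n r τ α β hτ hα hβ hle hdom h1
  have hτm : MeasurableSet τ := IsSemialgebraic.measurableSet_holds hτ
  have hBm : MeasurableSet r.domain := KZ.IntegralRep.measurableSet_domain_holds r
  -- honesty of the base representation: `β - α` is absolutely integrable on `τ`
  have hint : IntegrableOn (fun x => β x - α x) τ := by
    refine ⟨KZ.aestronglyMeasurable_of_isSemialgebraicFunOn
      (IsSemialgebraicFunOn.sub_holds hβ hα) hτm, ?_⟩
    rw [hasFiniteIntegral_iff_ofReal ((ae_restrict_mem hτm).mono fun x hx =>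
      sub_nonneg.2 (hle x hx)), BandArea.lintegral_width_eq_volume hτm hBm hdom]
    exact BandArea.volume_lt_top_of_eqOn_one r h1
  let r' : KZ.IntegralRep n :=
    ⟨τ, fun x => β x - α x, hτ, IsSemialgebraicFunOn.sub_holds hβ hα, hint⟩
  -- membership in the band, fibrewise
  have hmem : ∀ (x : Fin n → ℝ) (t : ℝ),
      (Fin.snoc x t : Fin (n + 1) → ℝ) ∈ r.domain ↔ x ∈ τ ∧ t ∈ Icc (α x) (β x) := by
    intro x t
    rw [hdom]
    simp only [mem_setOf_eq, Fin.init_snoc, Fin.snoc_last, mem_Icc]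
  refine ⟨r', rfl, rfl, KZ.newtonLeibnizRel_subset_relations ⟨n, r, r', α, β,
    fun z => z (Fin.last n), isSemialgebraicFunOn_apply r.isSemialgebraic_domain (Fin.last n),
    hα, hβ, hle, hdom, fun x _ => ?_, fun x hx t ht => ?_, fun x _ => ?_, rfl⟩⟩
  · -- `t ↦ F (x, t) = t` is continuous on the closed fibre
    simp only [Fin.snoc_last]
    exact continuousOn_id
  · -- `∂/∂t F (x, t) = 1 = r.integrand (x, t)` on the open fibre
    simp only [Fin.snoc_last]
    rw [h1 ((hmem x t).2 ⟨hx, Ioo_subset_Icc_self ht⟩)]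
    exact hasDerivAt_id t
  · -- `r'.integrand x = F (x, β x) - F (x, α x)`
    simp only [Fin.snoc_last, r']
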